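import Literature.Analysis.FluidPDE.TaoCascadeZeroScaleDrainFinal
import Literature.Analysis.FluidPDE.TaoCascadeReducedClaimIIFromSettingLargeK
import HarnessLib

/-!
# Tao's cascade ODE, §6.5–6.7: Prop. 6.12 (reduced induction claim) holds — `reducedClaimCorrected`

T. Tao, *Finite time blowup for an averaged three-dimensional Navier–Stokes equation*,
J. Amer. Math. Soc. 29 (2016), 601–674 = arXiv:1402.0290v3, §6.5 Prop. 6.12, §6.6 Props. 6.13, 6.15
and the sentence after Prop. 6.15 ("Proposition 6.12 follows from Proposition 6.15 and
Proposition 6.13 once we set `μ₁ := a₁(τ₁)` (and take `K` sufficiently large, `ε` sufficiently small,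
and `n₀` sufficiently large)"), §6.7 (proof of Prop. 6.15, closing with "This (finally!) completes the
proof of Proposition 6.15").

This file discharges the named fact `reducedClaimCorrected` (`TaoCascadeReducedClaim.lean`: Tao's
Prop. 6.12 with the author-corrected `X₃`-coefficient `10⁻⁵e^{-K¹⁰/2}`, stated in the regime of
Prop. 6.5 for an arbitrary bootstrap time) by composing the landed pieces of §6.5–6.7:

* `reducedClaimCorrected_of_inputs` (`TaoCascadeReducedClaimAssembly.lean`): Prop. 6.12 from the two
  regime inputs `SmallScaleOneInput` (Prop. 6.13) and `ReducedClaimIIInput` (Prop. 6.15), via Cor. 6.14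
  and `μ₁ := a₁(τ₁)`;
* `smallScaleOneInput_holds` (`TaoCascadeSmallScaleOneInRegime.lean`): Prop. 6.13 in the regime
  (from the repaired bootstrap of `TaoCascadeScaleOne*.lean`);
* `reducedClaimIIInput_of_setting_of_le` (`TaoCascadeReducedClaimIIFromSettingLargeK.lean`): Prop. 6.15
  in the regime from any proof of Prop. 6.15 in the `ZeroScale.Setting` packaging of §6.7 under an
  extra threshold `K₁ ≤ K` ("`K` sufficiently large");
* `ZeroScale.Setting.exists_nextState` (`TaoCascadeZeroScaleDrainFinal.lean`): Prop. 6.15 in the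
  setting for `K ≥ 10¹⁸` — the §6.7 chain `t_c` (`…ZeroScaleCritical`), `τ₁` and Prop. 6.16
  (`…ZeroScaleTauOne`), Prop. 6.17 (`…ZeroScaleCoarseBound/Levels`), the fence (6.186)–(6.188)
  (`…ZeroScaleFence`), the drain (6.174) and the state bounds (6.139)–(6.144)
  (`…ZeroScaleDrainFinal`, `…ZeroScaleNextState`).

Also recorded: the corrected Prop. 6.5 (`rescaledStepCorrected'`, `C₃` before `K₀`) which the same
inputs give (`rescaledStepCorrected'_holds`). Theorems only.

## References

* T. Tao, J. Amer. Math. Soc. 29 (2016), 601–674 = arXiv:1402.0290v3, §6.5 Prop. 6.12, §6.6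
  Props. 6.13, 6.15, §6.7. [`Tao2016AveragedNS`]
-/

noncomputable section

open Set

namespace Literature.Analysis.FluidPDE

namespace TaoCascade

/-- **Prop. 6.15 in the regime of Prop. 6.5 (`ReducedClaimIIInput`)**, from the `Setting`-based
Prop. 6.15 `ZeroScale.Setting.exists_nextState` (threshold `K ≥ 10¹⁸`).
[cite: Tao2016AveragedNS, §6.6 Prop. 6.15; §6.7] -/
theorem reducedClaimIIInput_holds : ReducedClaimIIInput :=
  reducedClaimIIInput_of_setting_of_le ((10 : ℝ) ^ 18)
    fun _ _ _ _ _ _ _ _ _ _ _ _ _ _ hs hK hex => hs.exists_nextState hK hex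

/-- **Tao's Prop. 6.12 (reduced induction claim) with the corrected coefficient `10⁻⁵e^{-K¹⁰/2}`
holds**: the named fact `reducedClaimCorrected` of `TaoCascadeReducedClaim.lean`, discharged from
Prop. 6.13 (`smallScaleOneInput_holds`) and Prop. 6.15 (`reducedClaimIIInput_holds`) by the assembly
`reducedClaimCorrected_of_inputs` ("Proposition 6.12 follows from Proposition 6.15 and
Proposition 6.13 once we set `μ₁ := a₁(τ₁)`").
[cite: Tao2016AveragedNS, §6.5 Prop. 6.12; §6.6, the sentence after Prop. 6.15] -/
theorem reducedClaimCorrected_holds : reducedClaimCorrected :=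
  reducedClaimCorrected_of_inputs smallScaleOneInput_holds reducedClaimIIInput_holds

/-- **The corrected Prop. 6.5 in the form `rescaledStepCorrected'`** (`C₃` fixed before `K₀`), from
the same two inputs. [cite: Tao2016AveragedNS, §6.4 Prop. 6.5, §6.5–6.7] -/
theorem rescaledStepCorrected'_holds : rescaledStepCorrected' :=
  rescaledStepCorrected'_of_reducedClaimIIInput reducedClaimIIInput_holds

end TaoCascade

end Literature.Analysis.FluidPDE
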